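import Summits.ResolutionOfSingularities.ResolutionOfSingularities.Theorems.PurelyInseparableDim4ResConeLossyTiltFreeLegality
import HarnessLib
import HarnessLib.Audit.Tags

/-!
# Purely inseparable four-folds — THE SEED DICHOTOMY after a lose-both cycle (p = 5, d = 4): the re-entry child
# carries `x_a⁴x_{a′}⁴` or `x_a⁴x_{a′}⁵`
# (K2(p) lane, SLICE C, tilt-free D∞ brick, FILE 1c: (D2)-seed of the plan of record; file-holder res-dim4-p-5 g4)

[OURS · counted 0 · cell `res-dim4-pi` · K2(p) lane, slice C (desk WORDS #128 (h), #130 (b)) · seat p-5 g4.]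
Nothing here proves K2(p), `NoIsolatedTrap p p` or resolution of singularities in dimension ≥ 4 / char. `p`.

Setting of `…LossyTiltFreeLegality` (three polynomials, steps modulo `5`-th-power noise).
* **`rowNine_ne_zero`** — the isolation AXIS WINDOW of the lose-both child (one monomial of `F₁` of off-`a′` mass
  `< 5`, `…LossyPairLedger.exists_mem_support_offAxis_lt`) is realised only by the degree-`9` inert-free row of the
  parent: `(λ, μ) ≠ (0, 0)`;
* `chartExponent_two_right/left`, `two_apply` — two-letter exponent bookkeeping;
* **`seed_coeff`** — `coeff_{x_a⁴x_{a′}⁴} F₂ = t^β(λ + μt)` and, if `λ + μt = 0`, `coeff_{x_a⁴x_{a′}⁵} F₂ = t^β μ` (idea-4's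
  images x²ỹ³ / x²ỹ⁴ of `F = T_ỹ ∘ T_x ∘ S_t`, the unit `x_a^α(x_{a′} + t x_a)^β` of the polynomial model included);
* **`seed_dichotomy`** — HEADLINE: `x_a⁴x_{a′}⁴ ∈ F₂` or `x_a⁴x_{a′}⁵ ∈ F₂`.
Numerics (not part of the proof): the two seed identities and «lower window ⟺ Frobenius row» were replayed in a literal
model of `CentreBlowup.step` over `𝔽₅` (p-5 g4 session folder `work/sim/`, 0 disagreements).
[cite: CossartJannsenSaito2020, Thm. 3.14, Lemma 13.2, Thm. 13.7] [cite: Hauser2010, §I (definition of P⁺)]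
bears_on: LADDER-RESOLUTION:D157-DOOR2 (res-dim4-pi · K2(p) = `RidgeBudget.NoAboveFloorTrap p p` · slice C, lossy residual,
D∞ tilt-free).  Supports stmt-ResolutionOfSingularities-16155 (helper).
-/

set_option linter.dupNamespace false -- mandated namespace of this single-conjunct summit

noncomputable section

namespace Summit.ResolutionOfSingularities.ResolutionOfSingularities.Theorems.PIDim4

namespace ResCone

open MvPolynomial Finset
open Literature.AlgebraicGeometry.Resolution
open Literature.AlgebraicGeometry.Resolution.CentreBlowup
open Literature.AlgebraicGeometry.Resolution.Hauser2010

variable {K : Type} [Field K]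

section Window

/-- **(D1), NON-VANISHING: THE FROBENIUS ROW IS NOT ZERO** — the isolation AXIS WINDOW of the lose-both child
(some monomial of `F₁` has off-`a′` mass `< 5`, `…LossyPairLedger.exists_mem_support_offAxis_lt`) must be
realised by the degree-`9` inert-free row of the parent: the degree-`7` row is purely inert (tilt-free cone), the
degree-`8` rows of inert degree `≤ 1` are absent (`coeff_eq_zero_of_degree_eight`), noise has `x_a`-exponent `≥ 5`.
Hence `(λ, μ) ≠ (0, 0)`. [OURS] [cite: CossartJannsenSaito2020, Thm. 3.14, Thm. 13.7] -/
theorem rowNine_ne_zero {a a' : Fin 4} (haa : a ≠ a') {α β : ℕ} (hαβ : α + β = 3)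
    {t : K} (ht : t ≠ 0) [CharP K 5] {F F₁ F₂ : MvPolynomial (Fin 4) K}
    (hF : ∀ m ∈ F.support, Finsupp.single a α + Finsupp.single a' β ≤ m ∧ 7 ≤ m.degree ∧
      (m.degree = 7 → degIn ((Finset.univ.erase a).erase a') m = 4))
    (hS1 : ∀ e : Fin 4 →₀ ℕ, 5 ≤ e.degree → ¬ IsPthPowerExponent 5 (chartExponent 5 Finset.univ a e) →
      coeff (chartExponent 5 Finset.univ a e) F₁ = coeff e (shear a (Pi.single a' t) F))
    (hS1' : ∀ e' ∈ F₁.support, ¬ IsPthPowerExponent 5 e' →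
      ∃ e ∈ (shear a (Pi.single a' t) F).support, chartExponent 5 Finset.univ a e = e')
    (hF₁ : ∀ e' ∈ F₁.support, 6 ≤ e'.degree ∧ 2 ≤ e' a)
    (hS2 : ∀ e' : Fin 4 →₀ ℕ, 5 ≤ e'.degree → ¬ IsPthPowerExponent 5 (chartExponent 5 Finset.univ a' e') →
      coeff (chartExponent 5 Finset.univ a' e') F₂ = coeff e' F₁)
    (hF₂ : ∀ E ∈ F₂.support, 7 ≤ E.degree ∧ (E.degree = 7 → E a = 2))
    (hwin : ∃ e' ∈ F₁.support, degIn (Finset.univ.erase a') e' < 5) :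
    coeff (Finsupp.single a α + Finsupp.single a' β + (Finsupp.single a (6 - 5) + Finsupp.single a' 5)) F ≠ 0 ∨
    coeff (Finsupp.single a α + Finsupp.single a' β + (Finsupp.single a (6 - 6) + Finsupp.single a' 6)) F ≠ 0 := by
  set P := (Finset.univ.erase a).erase a' with hP
  set r : Fin 4 →₀ ℕ := Finsupp.single a α + Finsupp.single a' β with hrdef
  have hr : ∀ m ∈ F.support, r ≤ m := fun m hm => (hF m hm).1
  have hF₁' : ∀ e' ∈ F₁.support, 6 ≤ e'.degree := fun e' he' => (hF₁ e' he').1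
  by_contra hboth
  push Not at hboth
  obtain ⟨hlam, hmu⟩ := hboth
  obtain ⟨e', he', hlt⟩ := hwin
  have hsum : degIn (Finset.univ.erase a') e' + e' a' = e'.degree := by
    rw [← degIn_univ, degIn, degIn, Finset.sum_erase_add _ _ (Finset.mem_univ a')]
  by_cases hpth : IsPthPowerExponent 5 e'
  · -- noise has `x_a`-exponent divisible by `5` and `≥ 2`, hence `≥ 5`: off-`a′` mass `≥ 5`
    have h2 := (hF₁ e' he').2
    have hdvd : 5 ∣ e' a := hpth a (Finsupp.mem_support_iff.mpr (by omega))
    have hle : e' a ≤ degIn (Finset.univ.erase a') e' :=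
      Finset.single_le_sum (f := fun i => e' i) (fun i _ => Nat.zero_le _)
        (Finset.mem_erase.mpr ⟨haa, Finset.mem_univ a⟩)
    omega
  obtain ⟨e, he, hee'⟩ := hS1' e' he' hpth
  obtain ⟨m, hm, l, hl, hem⟩ := exists_of_mem_support_shear_single haa t F he
  obtain ⟨hrm, h7, h7eq⟩ := hF m hm
  -- bookkeeping: `|e| = |m|`, inert degrees agree, `e_{a′} = m_{a′} − l`
  have hea : e a = m a + l := by rw [hem, shear_target_apply haa, if_pos rfl]
  have hea' : e a' = m a' - l := by rw [hem, shear_target_apply haa, if_neg haa.symm, if_pos rfl]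
  have hκ : degIn P e = degIn P m := Finset.sum_congr rfl fun i hi => by
    have hia' : i ≠ a' := Finset.ne_of_mem_erase hi
    have hia : i ≠ a := Finset.ne_of_mem_erase (Finset.mem_of_mem_erase hi)
    rw [hem, shear_target_apply haa, if_neg hia, if_neg hia']
  have hdege : e.degree = m.degree := by
    rw [degree_eq_apply_add_apply_add_degIn haa e, degree_eq_apply_add_apply_add_degIn haa m, ← hP, hκ, hea, hea']
    omega
  have h5e : 5 ≤ e.degree := by omega
  have hdeg' : e'.degree + 5 + e a = 2 * e.degree := by rw [← hee']; exact degree_chartExponent_univ 5 a h5e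
  have he'a' : e' a' = e a' := by rw [← hee']; exact chartExponent_apply_of_ne 5 Finset.univ haa.symm e
  have hsplit := degree_eq_apply_add_apply_add_degIn haa m
  rw [← hP] at hsplit
  -- the window reads `|m| + |m|_inert < 10`
  have hwin' : m.degree + degIn P m < 10 := by omega
  have hne : coeff m F ≠ 0 := MvPolynomial.mem_support_iff.mp hm
  rcases Nat.lt_or_ge m.degree 9 with hlt9 | hge9
  · rcases Nat.lt_or_ge m.degree 8 with hlt8 | hge8
    · -- `|m| = 7`: purely inert row, off-axis mass `4 + 2 + …` — contradiction
      have := h7eq (by omega)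
      omega
    · -- `|m| = 8`, inert degree `≤ 1`: absent by legality
      exact hne (coeff_eq_zero_of_degree_eight haa hαβ ht hr hS1 hF₁' hS2 hF₂ (by omega) (by rw [← hP]; omega))
  · -- `|m| = 9`, inert-free: a Frobenius row coefficient with `λ = μ = 0`
    have h9 : m.degree = 9 := by omega
    have hκ0 : degIn P m = 0 := by omega
    set f := m - r with hfdef
    have hmf : m = r + f := (add_tsub_cancel_of_le hrm).symm
    have hrdeg : r.degree = 3 := by rw [hrdef, map_add, Finsupp.degree_single, Finsupp.degree_single, hαβ]
    have hfdeg : f.degree = 6 := by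
      have := congrArg Finsupp.degree hmf
      rw [map_add, h9, hrdeg] at this
      omega
    have hκf : degIn P f = 0 := by
      have := hκ0
      rw [hmf, degIn_add, hP, degIn_passive_pair, zero_add] at this
      exact this
    obtain ⟨hμP, hμdeg⟩ := degIn_passive_erase haa f
    have hμ0 : (f.erase a).erase a' = 0 := by
      rw [← Finsupp.degree_eq_zero_iff, hμdeg, ← hP, hκf]
    have hfsplit := degree_eq_apply_add_apply_add_degIn haa f
    have hf : f = Finsupp.single a (6 - f a') + Finsupp.single a' (f a') := by
      have h : f = Finsupp.single a (f a + f a' - f a') + Finsupp.single a' (f a') + (f.erase a).erase a' := by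
        ext i
        rw [rowExp_add_apply haa (by rw [Finsupp.erase_ne haa, Finsupp.erase_same])
          (by rw [Finsupp.erase_same]) (f a + f a') (f a') i]
        by_cases hia : i = a
        · rw [if_pos hia, hia]; omega
        · rw [if_neg hia]
          by_cases hia' : i = a'
          · rw [if_pos hia', hia']
          · rw [if_neg hia', Finsupp.erase_ne hia', Finsupp.erase_ne hia]
      rw [hμ0, add_zero] at h
      rw [← hP, hκf] at hfsplit
      rw [show f a + f a' = 6 by omega] at h
      exact h
    have hrow := (rowNine_frobenius haa hαβ ht hr hS1 hF₁' hS2 hF₂).1 (f a') (by rw [← hP, hκf] at hfsplit; omega)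
    rw [← hf, ← hmf, hlam, hmu, mul_zero] at hrow
    simp only [ite_self, add_zero, sub_zero] at hrow
    exact hne hrow

end Window

section Seed

/-- The chart law on a two-letter exponent `u e_a + v e_{a′}` in the chart `a′`: `(u, u + v − 5)`. [folklore] -/
theorem chartExponent_two_right {a a' : Fin 4} (haa : a ≠ a') (u v w : ℕ) (hw : u + v = w + 5) :
    chartExponent 5 Finset.univ a' (Finsupp.single a u + Finsupp.single a' v) =
      Finsupp.single a u + Finsupp.single a' w := by
  ext i
  rw [chartExponent_apply, degIn_univ, map_add, Finsupp.degree_single, Finsupp.degree_single]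
  by_cases hia' : i = a'
  · subst hia'
    rw [if_pos rfl, Finsupp.add_apply, Finsupp.single_eq_of_ne haa.symm, Finsupp.single_eq_same, zero_add]
    omega
  · rw [if_neg hia', Finsupp.add_apply, Finsupp.add_apply, Finsupp.single_eq_of_ne hia',
      Finsupp.single_eq_of_ne hia']

/-- The chart law on a two-letter exponent `u e_a + v e_{a′}` in the chart `a`: `(u + v − 5, v)`. [folklore] -/
theorem chartExponent_two_left {a a' : Fin 4} (haa : a ≠ a') (u v w : ℕ) (hw : u + v = w + 5) :
    chartExponent 5 Finset.univ a (Finsupp.single a u + Finsupp.single a' v) =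
      Finsupp.single a w + Finsupp.single a' v := by
  have h := chartExponent_two_right (a := a') (a' := a) haa.symm v u w (by omega)
  rw [add_comm (Finsupp.single a' v), add_comm (Finsupp.single a' v)] at h
  exact h

/-- Evaluation of a two-letter exponent. [folklore] -/
theorem two_apply {a a' : Fin 4} (haa : a ≠ a') (u v : ℕ) (i : Fin 4) :
    (Finsupp.single a u + Finsupp.single a' v : Fin 4 →₀ ℕ) i = if i = a then u else if i = a' then v else 0 := by
  rw [Finsupp.add_apply, Finsupp.single_apply, Finsupp.single_apply]
  by_cases hia : i = a
  · rw [if_pos hia.symm, if_pos hia, if_neg (fun h => haa (h.trans hia).symm), add_zero]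
  · rw [if_neg (Ne.symm hia), if_neg hia, zero_add]
    by_cases hia' : i = a'
    · rw [if_pos hia'.symm, if_pos hia']
    · rw [if_neg (Ne.symm hia'), if_neg hia']

/-- **(D2)-SEED: THE TWO MARKER COEFFICIENTS OF THE RE-ENTRY CHILD.**  In the setting of `rowNine_frobenius`:
`coeff_{x_a⁴ x_{a′}⁴} F₂ = t^β (λ + μ t)` and, when `λ + μ t = 0`, `coeff_{x_a⁴ x_{a′}⁵} F₂ = t^β μ` (idea-4's x²ỹ³ /
x²ỹ⁴ after `F = T_ỹ ∘ T_x ∘ S_t`, with the unit `x_a^α (x_{a′} + t x_a)^β` of the polynomial model accounted for).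
[OURS] [cite: CossartJannsenSaito2020, Lemma 13.2, Thm. 13.7] -/
theorem seed_coeff {a a' : Fin 4} (haa : a ≠ a') {α β : ℕ} (hαβ : α + β = 3)
    {t : K} (ht : t ≠ 0) [CharP K 5] {F F₁ F₂ : MvPolynomial (Fin 4) K}
    (hr : ∀ m ∈ F.support, Finsupp.single a α + Finsupp.single a' β ≤ m)
    (hS1 : ∀ e : Fin 4 →₀ ℕ, 5 ≤ e.degree → ¬ IsPthPowerExponent 5 (chartExponent 5 Finset.univ a e) →
      coeff (chartExponent 5 Finset.univ a e) F₁ = coeff e (shear a (Pi.single a' t) F))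
    (hF₁ : ∀ e' ∈ F₁.support, 6 ≤ e'.degree)
    (hS2 : ∀ e' : Fin 4 →₀ ℕ, 5 ≤ e'.degree → ¬ IsPthPowerExponent 5 (chartExponent 5 Finset.univ a' e') →
      coeff (chartExponent 5 Finset.univ a' e') F₂ = coeff e' F₁)
    (hF₂ : ∀ E ∈ F₂.support, 7 ≤ E.degree ∧ (E.degree = 7 → E a = 2)) :
    coeff (Finsupp.single a 4 + Finsupp.single a' 4) F₂ =
      t ^ β * (coeff (Finsupp.single a α + Finsupp.single a' β +
          (Finsupp.single a (6 - 5) + Finsupp.single a' 5)) F +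
        coeff (Finsupp.single a α + Finsupp.single a' β +
          (Finsupp.single a (6 - 6) + Finsupp.single a' 6)) F * t) ∧
    (coeff (Finsupp.single a α + Finsupp.single a' β + (Finsupp.single a (6 - 5) + Finsupp.single a' 5)) F +
        coeff (Finsupp.single a α + Finsupp.single a' β +
          (Finsupp.single a (6 - 6) + Finsupp.single a' 6)) F * t = 0 →
      coeff (Finsupp.single a 4 + Finsupp.single a' 5) F₂ =
        t ^ β * coeff (Finsupp.single a α + Finsupp.single a' β +
          (Finsupp.single a (6 - 6) + Finsupp.single a' 6)) F) := by
  set r : Fin 4 →₀ ℕ := Finsupp.single a α + Finsupp.single a' β with hrdef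
  set G := F.divMonomial r with hG
  set lam := coeff (r + (Finsupp.single a (6 - 5) + Finsupp.single a' 5)) F with hlam
  set mu := coeff (r + (Finsupp.single a (6 - 6) + Finsupp.single a' 6)) F with hmu
  obtain ⟨-, hrowG⟩ := rowNine_frobenius haa hαβ ht hr hS1 hF₁ hS2 hF₂
  have hFG : shear a (Pi.single a' t) F = (∑ l ∈ Finset.range (β + 1),
      monomial (Finsupp.single a (α + l) + Finsupp.single a' (β - l)) (((β.choose l : ℕ) : K) * t ^ l)) *
      shear a (Pi.single a' t) G := by
    conv_lhs => rw [eq_monomial_mul_divMonomial hr]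
    rw [shear_mul, shear_monomial_pair haa]
  have hβ3 : β ≤ 3 := by omega
  -- the transports to the sheared parent, evaluated on the Frobenius row
  have heval : ∀ u v : ℕ, u + v = 9 → 5 ≤ v → v ≤ 6 →
      coeff (Finsupp.single a u + Finsupp.single a' v) (shear a (Pi.single a' t) F) =
        ∑ l ∈ Finset.range (β + 1), ((β.choose l : ℕ) : K) * t ^ l *
          ((if v - β + l = 5 then lam + mu * t else 0) + (if v - β + l = 6 then mu else 0)) := by
    intro u v huv hv5 hv6
    rw [hFG, coeff_unitRow_mul]
    refine Finset.sum_congr rfl fun l hl => ?_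
    have hl' : l ≤ β := by have := Finset.mem_range.mp hl; omega
    have hle : Finsupp.single a (α + l) + Finsupp.single a' (β - l) ≤
        Finsupp.single a u + Finsupp.single a' v := Finsupp.le_def.mpr fun i => by
      rw [two_apply haa, two_apply haa]
      by_cases hia : i = a
      · rw [if_pos hia, if_pos hia]; omega
      · rw [if_neg hia, if_neg hia]
        by_cases hia' : i = a'
        · rw [if_pos hia', if_pos hia']; omega
        · rw [if_neg hia', if_neg hia']
    have hsub : Finsupp.single a u + Finsupp.single a' v - (Finsupp.single a (α + l) + Finsupp.single a' (β - l)) =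
        Finsupp.single a (6 - (v - β + l)) + Finsupp.single a' (v - β + l) := by
      ext i
      rw [Finsupp.tsub_apply, two_apply haa, two_apply haa, two_apply haa]
      by_cases hia : i = a
      · rw [if_pos hia, if_pos hia, if_pos hia]; omega
      · rw [if_neg hia, if_neg hia, if_neg hia]
        by_cases hia' : i = a'
        · rw [if_pos hia', if_pos hia', if_pos hia']; omega
        · rw [if_neg hia', if_neg hia', if_neg hia']
    rw [if_pos hle, hsub, hrowG (v - β + l) (by omega)]
  have h44a : (Finsupp.single a 4 + Finsupp.single a' 4 : Fin 4 →₀ ℕ) a = 4 := by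
    rw [two_apply haa, if_pos rfl]
  have h45a : (Finsupp.single a 4 + Finsupp.single a' 5 : Fin 4 →₀ ℕ) a = 4 := by
    rw [two_apply haa, if_pos rfl]
  have h46a : (Finsupp.single a 4 + Finsupp.single a' 6 : Fin 4 →₀ ℕ) a = 4 := by
    rw [two_apply haa, if_pos rfl]
  refine ⟨?_, fun hc5 => ?_⟩
  · -- `x_a⁴ x_{a′}⁴ ← x_a⁴ x_{a′}⁵ ← x_a⁴ x_{a′}⁵`
    have h2 := hS2 (Finsupp.single a 4 + Finsupp.single a' 5)
      (by rw [map_add, Finsupp.degree_single, Finsupp.degree_single]; omega)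
      (by rw [chartExponent_two_right haa 4 5 4 rfl]
          exact not_isPthPowerExponent_of_not_dvd (i := a) (by rw [h44a]; omega))
    rw [chartExponent_two_right haa 4 5 4 rfl] at h2
    have h1 := hS1 (Finsupp.single a 4 + Finsupp.single a' 5)
      (by rw [map_add, Finsupp.degree_single, Finsupp.degree_single]; omega)
      (by rw [chartExponent_two_left haa 4 5 4 rfl]
          exact not_isPthPowerExponent_of_not_dvd (i := a) (by rw [h45a]; omega))
    rw [chartExponent_two_left haa 4 5 4 rfl] at h1
    rw [h2, h1, heval 4 5 rfl le_rfl (by omega), Finset.sum_eq_single_of_mem β (Finset.mem_range.mpr (by omega))]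
    · rw [Nat.choose_self, Nat.cast_one, one_mul, if_pos (by omega), if_neg (by omega), add_zero]
    · intro l hl hlβ
      have hl' : l < β := lt_of_le_of_ne (by have := Finset.mem_range.mp hl; omega) hlβ
      rw [if_neg (by omega), if_neg (by omega), add_zero, mul_zero]
  · -- `x_a⁴ x_{a′}⁵ ← x_a⁴ x_{a′}⁶ ← x_a³ x_{a′}⁶`, with `λ + μ t = 0`
    have h2 := hS2 (Finsupp.single a 4 + Finsupp.single a' 6)
      (by rw [map_add, Finsupp.degree_single, Finsupp.degree_single]; omega)
      (by rw [chartExponent_two_right haa 4 6 5 rfl]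
          exact not_isPthPowerExponent_of_not_dvd (i := a) (by rw [h45a]; omega))
    rw [chartExponent_two_right haa 4 6 5 rfl] at h2
    have h1 := hS1 (Finsupp.single a 3 + Finsupp.single a' 6)
      (by rw [map_add, Finsupp.degree_single, Finsupp.degree_single]; omega)
      (by rw [chartExponent_two_left haa 3 6 4 rfl]
          exact not_isPthPowerExponent_of_not_dvd (i := a) (by rw [h46a]; omega))
    rw [chartExponent_two_left haa 3 6 4 rfl] at h1
    rw [h2, h1, heval 3 6 rfl (by omega) le_rfl, Finset.sum_eq_single_of_mem β (Finset.mem_range.mpr (by omega))]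
    · rw [Nat.choose_self, Nat.cast_one, one_mul, if_neg (by omega), if_pos (by omega), zero_add]
    · intro l hl hlβ
      have hl' : l < β := lt_of_le_of_ne (by have := Finset.mem_range.mp hl; omega) hlβ
      by_cases h5 : 6 - β + l = 5
      · rw [if_pos h5, if_neg (by omega), add_zero, hc5, mul_zero]
      · rw [if_neg h5, if_neg (by omega), add_zero, mul_zero]

end Seed

section Dichotomy

/-- **THE SEED DICHOTOMY (D1 ⇒ D2-seed)** — FILE-1 headline of the tilt-free D∞ brick.  Parent `F` (lose-both time,
weights `α e_a + β e_{a′}`, `α + β = 3`, tilt-free cone: degree-`7` row purely inert), pure-shear child `F₁` modulo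
`5`-th-power noise (`ord ≥ 6`, `x_a² ∣`, one isolation witness of off-`a′` mass `< 5`), pure-corner grandchild `F₂`
modulo noise with the tilt-free lower window (`ord ≥ 7`, degree `7` has `x_a`-exponent `2`).  THEN the grandchild
carries `x_a⁴ x_{a′}⁴` or `x_a⁴ x_{a′}⁵` (idea-4 E2 §D END GAME: «x″²ỹ″³ present, or x″²ỹ″⁴ present»).  Valid over
every field of characteristic `5`; `p = 5 = d + 1` enters through the Frobenius row and the numerology.
[OURS] [cite: CossartJannsenSaito2020, Lemma 13.2, Thm. 13.7] [cite: Hauser2010, §I (definition of P⁺)] -/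
theorem seed_dichotomy {a a' : Fin 4} (haa : a ≠ a') {α β : ℕ} (hαβ : α + β = 3)
    {t : K} (ht : t ≠ 0) [CharP K 5] {F F₁ F₂ : MvPolynomial (Fin 4) K}
    (hF : ∀ m ∈ F.support, Finsupp.single a α + Finsupp.single a' β ≤ m ∧ 7 ≤ m.degree ∧
      (m.degree = 7 → degIn ((Finset.univ.erase a).erase a') m = 4))
    (hS1 : ∀ e : Fin 4 →₀ ℕ, 5 ≤ e.degree → ¬ IsPthPowerExponent 5 (chartExponent 5 Finset.univ a e) →
      coeff (chartExponent 5 Finset.univ a e) F₁ = coeff e (shear a (Pi.single a' t) F))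
    (hS1' : ∀ e' ∈ F₁.support, ¬ IsPthPowerExponent 5 e' →
      ∃ e ∈ (shear a (Pi.single a' t) F).support, chartExponent 5 Finset.univ a e = e')
    (hF₁ : ∀ e' ∈ F₁.support, 6 ≤ e'.degree ∧ 2 ≤ e' a)
    (hS2 : ∀ e' : Fin 4 →₀ ℕ, 5 ≤ e'.degree → ¬ IsPthPowerExponent 5 (chartExponent 5 Finset.univ a' e') →
      coeff (chartExponent 5 Finset.univ a' e') F₂ = coeff e' F₁)
    (hF₂ : ∀ E ∈ F₂.support, 7 ≤ E.degree ∧ (E.degree = 7 → E a = 2))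
    (hwin : ∃ e' ∈ F₁.support, degIn (Finset.univ.erase a') e' < 5) :
    coeff (Finsupp.single a 4 + Finsupp.single a' 4) F₂ ≠ 0 ∨
    coeff (Finsupp.single a 4 + Finsupp.single a' 5) F₂ ≠ 0 := by
  have hr : ∀ m ∈ F.support, Finsupp.single a α + Finsupp.single a' β ≤ m := fun m hm => (hF m hm).1
  have hF₁' : ∀ e' ∈ F₁.support, 6 ≤ e'.degree := fun e' he' => (hF₁ e' he').1
  obtain ⟨h44, h45⟩ := seed_coeff haa hαβ ht hr hS1 hF₁' hS2 hF₂
  have hne := rowNine_ne_zero haa hαβ ht hF hS1 hS1' hF₁ hS2 hF₂ hwin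
  set lam := coeff (Finsupp.single a α + Finsupp.single a' β +
    (Finsupp.single a (6 - 5) + Finsupp.single a' 5)) F with hlam
  set mu := coeff (Finsupp.single a α + Finsupp.single a' β +
    (Finsupp.single a (6 - 6) + Finsupp.single a' 6)) F with hmu
  by_cases hc5 : lam + mu * t = 0
  · right
    rw [h45 hc5]
    have hmu0 : mu ≠ 0 := fun h0 => by
      rcases hne with hl | hm
      · apply hl
        have : lam = -(mu * t) := eq_neg_of_add_eq_zero_left hc5
        rw [this, h0, zero_mul, neg_zero]
      · exact hm h0
    exact mul_ne_zero (pow_ne_zero _ ht) hmu0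
  · left
    rw [h44]
    exact mul_ne_zero (pow_ne_zero _ ht) hc5

end Dichotomy

end ResCone

end Summit.ResolutionOfSingularities.ResolutionOfSingularities.Theorems.PIDim4

end
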